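import Literature.AnabelianGeometry.SemiGraphs.TemperoidsGaloisTorsorProofs
import Literature.AnabelianGeometry.EtaleTheta.TemperedFrobenioid
import HarnessLib

/-!
# [EtTh] Def. 3.6 (ii) over the FULL temperoid `B^temp(Π)`: a VACUITY certificate — `B^temp(Π)` is not totally epimorphic,
# so no tempered Frobenioid has base category `B^temp(Π)` (the genuine base is the connected part `B^temp(Π)⁰`)

Mochizuki, *The étale theta function …*, Publ. RIMS **45** (2009), Def. 3.6 (ii) p.302 (PDF p.76): "Let `D` be a connected,
totally epimorphic category, equipped with a functor `D → D₀` …" [cite: MochizukiEtTh2009, Def 3.6 p.302 (PDF p.76)];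
Mochizuki, *Semi-graphs of anabelioids*, Publ. RIMS **42** (2006), §3 p.33: `B^temp(Π)` = countable discrete sets with continuous
`Π`-action; [FrdI] §0 p.15 "totally epimorphic" = every arrow is an epimorphism [cite: MochizukiSemiAnbd2006, §3 p.33].

PROOF-ONLY kernel certificate (no definitions; seat abc-iut-w4-d099, cell abc-iut layer L2, found while working row #5-R43).
The tree's `TemperedFrobenioid T D VD` ([EtTh] Def. 3.6 (ii), abc-iut-L2-t3) carries the field
`isTotallyEpimorphic : IsTotallyEpimorphic D`.  Several L2 files instantiate the base category as the FULL temperoid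
`D := BTemp Π` (abc-iut-L3's `SemiGraphs.BTemp`: ALL countable discrete continuous `Π`-sets, including the disconnected and the
two-point trivial ones) — e.g. the `section Canonical` of `Discharge/Sec4GaloisSurjNaturalModel.lean`
(`tf : TemperedFrobenioid T (BTemp X.Pi) VD`) and `Discharge/Sec5OfTemperoidModelData.lean` (`BiKummerSetting.mkOfTemperoid`,
`ThetaFrobenioid.ofTemperoidData`, `ThetaFrobenioidTower.ofTemperoidFamily`, all parametrised by such a `tf`).  This file shows
that parameter type is EMPTY:
* `BTemp.not_isTotallyEpimorphic` — `B^temp(Π)` is NOT totally epimorphic, for every topological group `Π`: on the two-point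
  object `Ω = {0,1}` with trivial action, the constant endomorphism `c₀ : Ω → Ω` equalises `𝟙_Ω` and `c₀` although `𝟙_Ω ≠ c₀`, so
  `c₀` is not an epimorphism;
* `TemperedFrobenioid.isEmpty_of_bTemp` — hence `IsEmpty (TemperedFrobenioid T (BTemp Π) VD)`: every declaration taking a
  tempered Frobenioid OVER `BTemp Π` as a parameter is vacuously parametrised (kernel-true, content-free).
REPAIR (not done here; owners abc-iut-L2-t4 / abc-iut-L2-t9 / abc-iut-w5-d013): take `D := ConnectedPart (BTemp Π) = B^temp(Π)⁰`
(print's superscript `0`; abc-iut-L2-t9's `thetaSubquotientStub` already lives there), for which total epimorphicity is the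
tree's theorem `QuasiTemperoid.connectedPartIsTotallyEpimorphic_holds` ([FrdII] Ex. 1.3 (i), stated for `B^temp(Π, Π°)⁰`).
Nothing of [EtTh] is asserted or refuted — this is a statement about OUR choice of parameter category; no side taken on
[IUTchIII] Cor. 3.12.
-/

open CategoryTheory

universe u

namespace Literature.AnabelianGeometry.SemiGraphs

open Literature.AlgebraicGeometry.Frobenioids (IsTotallyEpimorphic)
open Literature.AlgebraicGeometry.Frobenioids.QuasiTemperoid.BTempConnected

namespace BTemp

variable (G : Type u) [Group G] [TopologicalSpace G]

/-- **`B^temp(Π)` is not totally epimorphic**: the constant endomorphism of the two-point trivial object `{0,1}` is not an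
epimorphism (it equalises the identity and itself-as-constant, which differ at `1`).  [cite: MochizukiSemiAnbd2006, §3 p.33] -/
theorem not_isTotallyEpimorphic : ¬ IsTotallyEpimorphic (BTemp G) := by
  intro hte
  -- the two-point object with trivial action and its stable subset `{0}`
  let W : BTemp G := ⟨{ V := ULift.{u} Bool, ρ := 1 }, ⟨inferInstance, fun _ => by simp⟩⟩
  have hI : ∀ (g : G) (w : W.obj.V), w ∈ ({⟨false⟩} : Set W.obj.V) → W.obj.ρ g w ∈ ({⟨false⟩} : Set W.obj.V) :=
    fun _ _ hw => hw
  obtain ⟨Ω, u₁, u₂, hagree, hne⟩ :=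
    GaloisTorsor.exists_hom_pair_of_not_mem W {⟨false⟩} hI ⟨true⟩ (by
      intro h
      have h' : true = false := congrArg ULift.down (Set.mem_singleton_iff.mp h)
      exact Bool.noConfusion h')
  -- the constant endomorphism `c₀ : W → W` at the point `0`
  let c₀ : W ⟶ W := ObjectProperty.homMk
    { hom := TypeCat.ofHom fun _ => (⟨false⟩ : ULift.{u} Bool)
      comm := fun g => by
        apply ConcreteCategory.hom_ext
        intro w
        rfl }
  have hc : c₀ ≫ u₁ = c₀ ≫ u₂ := hom_ext_apply fun _ => hagree ⟨false⟩ rfl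
  haveI := hte.epi c₀
  exact hne (by rw [(cancel_epi c₀).mp hc])

end BTemp

end Literature.AnabelianGeometry.SemiGraphs

namespace Literature.AnabelianGeometry.EtaleTheta

namespace TemperedFrobenioid

open Literature.AnabelianGeometry.SemiGraphs

universe u₀ v₀ w

/-- **No tempered Frobenioid ([EtTh] Def. 3.6 (ii)) has base category the FULL temperoid `B^temp(Π)`**: the type
`TemperedFrobenioid T (BTemp Π) VD` is empty, because its field `isTotallyEpimorphic` cannot hold (`BTemp.not_isTotallyEpimorphic`).
Consequently every construction/theorem parametrised by `tf : TemperedFrobenioid T (BTemp Π) VD` is vacuous; the genuine base is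
`B^temp(Π)⁰`.  [cite: MochizukiEtTh2009, Def 3.6 p.302 (PDF p.76)] -/
theorem isEmpty_of_bTemp (G : Type u₀) [Group G] [TopologicalSpace G] {D₀ : Type u₀} [Category.{v₀} D₀]
    {V : FrdIMonoidStub.{w}} (T : RealifiedDivisorMonoids (D₀ := D₀) V) (VD : FrdICatStub.{u₀ + 1, u₀, w} (BTemp G)) :
    IsEmpty (TemperedFrobenioid T (BTemp G) VD) :=
  ⟨fun tf => BTemp.not_isTotallyEpimorphic G tf.isTotallyEpimorphic⟩

/-- Pointwise form: a tempered Frobenioid over `B^temp(Π)` yields `False`. [cite: MochizukiEtTh2009, Def 3.6 p.302 (PDF p.76)] -/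
theorem false_of_bTemp {G : Type u₀} [Group G] [TopologicalSpace G] {D₀ : Type u₀} [Category.{v₀} D₀]
    {V : FrdIMonoidStub.{w}} {T : RealifiedDivisorMonoids (D₀ := D₀) V} {VD : FrdICatStub.{u₀ + 1, u₀, w} (BTemp G)}
    (tf : TemperedFrobenioid T (BTemp G) VD) : False :=
  BTemp.not_isTotallyEpimorphic G tf.isTotallyEpimorphic

end TemperedFrobenioid

end Literature.AnabelianGeometry.EtaleTheta
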